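import Mathlib.Combinatorics.SimpleGraph.Walk.Counting
import Mathlib.Combinatorics.SimpleGraph.Paths
import HarnessLib

/-!
# Crux `BoundaryTP2` (stmt-CriticalPhenomena-7115), line `Sketch`: gluing lemma for the width-4 pair
recursion `stub_strip4_recPair312`

Helper for the tool stub `stub_strip4_recPair312` (4-row strip programme: recursion of the
disjoint-pair kernel with the loop at the middle pair of the last column). Setting
(`strip4_recPair312_glue`): a graph `G` on `V` containing `G₀`, four fresh vertices `t, m, tb, c`
(the last column `m₃, m₁, m₂, m₀` of the strip) with `N(t) ⊆ {ps, tb}`, `N(m) ⊆ {p1, c, tb}`,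
`N(tb) ⊆ {psb, m, t}`, `N(c) ⊆ {pc, m}`, the edges of `G` between old vertices being edges of `G₀`
and the edges of `G₀` ending at old vertices. A vertex-disjoint pair of self-avoiding paths
`(γ : a → t, γ' : m → tb)` of `G` is `γ = γ₀ · (ps t)` with `γ₀` a path of `G₀` (`γ` cannot enter
`t` from `tb ∈ γ'`, avoids `m, tb ∈ γ'`, and avoids the dead end `c`, whose other neighbour `m` is
not on `γ`: `s4p312_deadEnd`), and `γ'` is the rung `m tb`, or `m c pc · δ · psb tb` (from the
corner `c` the only way on is `pc`), or `m p1 · δ · psb tb`, with `δ` a path of `G₀` (`tb` is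
entered from `psb` since `t ∈ γ`; peeling by `s4p312_peel`, walk surgery by `Walk.transfer` /
`concat`). These three gluings form an injection whose range contains the disjoint pairs, preserving
disjointness, with lengths `(|γ₀|+1, 1)`, `(|γ₀|+1, |δ|+3)`, `(|γ₀|+1, |δ|+2)`. Mathlib only
(after `…Strip3RecPair`). [folklore]
-/

noncomputable section

namespace Summit.CriticalPhenomena.SAWScalingLimit.Theorems.BoundaryTP2

open SimpleGraph Walk

variable {V : Type*}

/-! ## Walk lemmas -/

/-- If every edge of `G` ends in `P`, a walk of `G` that starts in `P` stays in `P`. [folklore] -/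
private theorem s4p312_forall_mem_support {G : SimpleGraph V} {P : V → Prop}
    (hG : ∀ u v, G.Adj u v → P v) {u v : V} (p : G.Walk u v) (hu : P u) : ∀ z ∈ p.support, P z := by
  -- adapted from `s3p_forall_mem_support` (…BoundaryTP2Strip3RecPair)
  induction p with
  | nil => intro z hz; rw [support_nil, List.mem_singleton] at hz; exact hz ▸ hu
  | cons h q ih =>
    intro z hz
    rw [support_cons, List.mem_cons] at hz
    rcases hz with rfl | hz
    exacts [hu, ih (hG _ _ h) z hz]

/-- The edges of a walk of `H` whose vertices satisfy `P` lie in any graph `G` containing the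
`P`-internal edges of `H`. [folklore] -/
private theorem s4p312_edges_mem_of_support {H G : SimpleGraph V} {P : V → Prop}
    (hG : ∀ u v, H.Adj u v → P u → P v → G.Adj u v) {u v : V} (p : H.Walk u v)
    (hp : ∀ z ∈ p.support, P z) : ∀ e, e ∈ p.edges → e ∈ G.edgeSet := by
  induction p with
  | nil => intro e he; simp at he
  | cons h q ih =>
    intro e he
    rw [edges_cons, List.mem_cons] at he
    rcases he with rfl | he
    · exact (mem_edgeSet G).2 (hG _ _ h (hp _ (by simp)) (hp _ (by simp)))
    · exact ih (fun z hz => hp z (by simp [hz])) e he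

/-- The edges of a walk of a subgraph `G ≤ H` are edges of `H`. [folklore] -/
private theorem s4p312_edges_mem_of_le {G H : SimpleGraph V} (hle : G ≤ H) {u v : V}
    (p : G.Walk u v) : ∀ e, e ∈ p.edges → e ∈ H.edgeSet :=
  fun _ he => edgeSet_mono hle (p.edges_subset_edgeSet he)

/-- **Peeling the last edge.** A path `p : u → w` (`u ≠ w`) of `H` whose last step can only come from
`e` and whose vertices `≠ w` satisfy `P` is `p₀ · (e w)` for a path `p₀ : u → e` of any `G ≤ H`
containing the `P`-internal edges of `H`. [folklore] -/
private theorem s4p312_peel {H G : SimpleGraph V} {P : V → Prop} (hle : G ≤ H)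
    (hG : ∀ u v, H.Adj u v → P u → P v → G.Adj u v) {u w e : V} (p : H.Walk u w) (hp : p.IsPath)
    (hne : u ≠ w) (hlast : ∀ v, H.Adj w v → v ∈ p.support → v = e)
    (hP : ∀ z ∈ p.support, z ≠ w → P z) :
    ∃ (p₀ : G.Walk u e) (h : H.Adj e w), p₀.IsPath ∧
      p = (p₀.transfer H (s4p312_edges_mem_of_le hle p₀)).concat h := by
  -- adapted from `s3p_peel` (…BoundaryTP2Strip3RecPair)
  obtain ⟨v, h, q, hq⟩ := exists_eq_cons_of_ne hne.symm p.reverse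
  have hsub : ∀ z ∈ q.support, z ∈ p.support := fun z hz => by
    rw [← List.mem_reverse, ← support_reverse, hq, support_cons]
    exact List.mem_cons_of_mem _ hz
  obtain rfl : v = e := hlast v h (hsub v q.start_mem_support)
  have hrev := hp.reverse
  rw [hq, cons_isPath_iff] at hrev
  have hPq : ∀ z ∈ q.reverse.support, P z := fun z hz => by
    rw [support_reverse, List.mem_reverse] at hz
    exact hP z (hsub z hz) fun hzw => hrev.2 (hzw ▸ hz)
  refine ⟨q.reverse.transfer G (s4p312_edges_mem_of_support hG _ hPq), h.symm,
    hrev.1.reverse.transfer _, ?_⟩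
  conv_lhs => rw [← reverse_reverse p, hq, reverse_cons]
  rw [transfer_transfer, transfer_self]
  rfl

/-- **Dead end.** A self-avoiding path with end-points off `c` containing no neighbour of `c` other
than `pc` does not visit `c`. [folklore] -/
private theorem s4p312_deadEnd {G : SimpleGraph V} {c pc : V} :
    ∀ {u v : V} (p : G.Walk u v), p.IsPath → u ≠ c → v ≠ c →
      (∀ z, G.Adj c z → z ∈ p.support → z = pc) → c ∉ p.support := by
  intro u v p
  induction p with
  | nil =>
    intro _ hu _ _ h
    rw [support_nil, List.mem_singleton] at h
    exact hu h.symm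
  | @cons u w _ h q ih =>
    intro hp hu hv hN hc
    rw [cons_isPath_iff] at hp
    rw [support_cons, List.mem_cons] at hc
    rcases hc with hc | hc
    · exact hu hc.symm
    by_cases hwc : w = c
    · subst hwc
      -- the path enters `c` from `pc` and must leave it through `pc` again
      have hupc : u = pc := hN u h.symm (by simp)
      obtain ⟨w', h', q', rfl⟩ := exists_eq_cons_of_ne (Ne.symm hv) q
      have hw' : w' = pc :=
        hN w' h' (List.mem_cons_of_mem _ (List.mem_cons_of_mem _ q'.start_mem_support))
      refine hp.2 ?_
      rw [hupc, ← hw', support_cons]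
      exact List.mem_cons_of_mem _ q'.start_mem_support
    · exact ih hp.1 hwc hv (fun z hz hzq => hN z hz (List.mem_cons_of_mem _ hzq)) hc

/-- The gluing `γ ↦ γ · (p t)` (after transfer to the big graph) is injective. [folklore] -/
private theorem s4p312_glue_inj {G₀ G : SimpleGraph V} (hle : G₀ ≤ G) {a p t : V} (hpt : G.Adj p t)
    {γ γ' : G₀.Walk a p} (h : (γ.transfer G (s4p312_edges_mem_of_le hle γ)).concat hpt =
      (γ'.transfer G (s4p312_edges_mem_of_le hle γ')).concat hpt) : γ = γ' := by
  have h' := congrArg edges h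
  simp only [edges_concat, edges_transfer, List.concat_eq_append] at h'
  exact edges_injective (List.append_cancel_right h')

/-! ## The gluing map of an abstract last column -/

/-- **The gluing map.** `G₀ ≤ G` on one vertex type; new vertices `t, m, tb, c` of `G` with
`N(t) ⊆ {ps, tb}`, `N(m) ⊆ {p1, c, tb}`, `N(tb) ⊆ {psb, m, t}`, `N(c) ⊆ {pc, m}`; the edges of `G`
between old vertices are edges of `G₀`, whose edges end at old vertices. Then
`γ₀ ↦ (γ₀ · ps t, m tb)`, `(γ₀, δ) ↦ (γ₀ · ps t, m c pc · δ · psb tb)` and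
`(γ₀, δ) ↦ (γ₀ · ps t, m p1 · δ · psb tb)` form an injection into `Path_G(a,t) × Path_G(m,tb)` whose
range contains every vertex-disjoint pair, preserving disjointness, with the stated lengths.
[folklore] -/
theorem strip4_recPair312_glue {V : Type*} {G₀ G : SimpleGraph V} {a ps p1 psb pc t m tb c : V}
    (hle : G₀ ≤ G)
    (hold : ∀ u v, G.Adj u v → (u ≠ t ∧ u ≠ m ∧ u ≠ tb ∧ u ≠ c) →
      (v ≠ t ∧ v ≠ m ∧ v ≠ tb ∧ v ≠ c) → G₀.Adj u v)
    (hG₀ : ∀ u v, G₀.Adj u v → v ≠ t ∧ v ≠ m ∧ v ≠ tb ∧ v ≠ c)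
    (ha : a ≠ t ∧ a ≠ m ∧ a ≠ tb ∧ a ≠ c) (hp1 : p1 ≠ t ∧ p1 ≠ m ∧ p1 ≠ tb ∧ p1 ≠ c)
    (hpc : pc ≠ t ∧ pc ≠ m ∧ pc ≠ tb ∧ pc ≠ c)
    (hpt : G.Adj ps t) (hmtb : G.Adj m tb) (hmp1 : G.Adj m p1) (hptb : G.Adj psb tb)
    (hmc : G.Adj m c) (hcpc : G.Adj c pc)
    (hNt : ∀ u, G.Adj t u → u = ps ∨ u = tb) (hNm : ∀ u, G.Adj m u → u = p1 ∨ u = c ∨ u = tb)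
    (hNtb : ∀ u, G.Adj tb u → u = psb ∨ u = m ∨ u = t) (hNc : ∀ u, G.Adj c u → u = pc ∨ u = m)
    (htm : t ≠ m) (httb : t ≠ tb) (htc : t ≠ c) (hmtb' : m ≠ tb) (hmc' : m ≠ c) (htbc : tb ≠ c) :
    ∃ g : G₀.Path a ps ⊕ ((G₀.Path a ps × G₀.Path pc psb) ⊕ (G₀.Path a ps × G₀.Path p1 psb)) →
        G.Path a t × G.Path m tb,
      Function.Injective g ∧
      (∀ q : G.Path a t × G.Path m tb, List.Disjoint q.1.1.support q.2.1.support →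
        q ∈ Set.range g) ∧
      (∀ γ₀, List.Disjoint (g (Sum.inl γ₀)).1.1.support (g (Sum.inl γ₀)).2.1.support ∧
        (g (Sum.inl γ₀)).1.1.length = γ₀.1.length + 1 ∧ (g (Sum.inl γ₀)).2.1.length = 1) ∧
      (∀ q, (List.Disjoint (g (Sum.inr (Sum.inl q))).1.1.support
          (g (Sum.inr (Sum.inl q))).2.1.support ↔ List.Disjoint q.1.1.support q.2.1.support) ∧
        (g (Sum.inr (Sum.inl q))).1.1.length = q.1.1.length + 1 ∧
        (g (Sum.inr (Sum.inl q))).2.1.length = q.2.1.length + 3) ∧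
      (∀ q, (List.Disjoint (g (Sum.inr (Sum.inr q))).1.1.support
          (g (Sum.inr (Sum.inr q))).2.1.support ↔ List.Disjoint q.1.1.support q.2.1.support) ∧
        (g (Sum.inr (Sum.inr q))).1.1.length = q.1.1.length + 1 ∧
        (g (Sum.inr (Sum.inr q))).2.1.length = q.2.1.length + 2) := by
  -- walks of `G₀` issued from `a`, `pc` or `p1` avoid the new vertices
  have hPa : ∀ {u : V} (w : G₀.Walk a u) (z : V), z ∈ w.support → z ≠ t ∧ z ≠ m ∧ z ≠ tb ∧ z ≠ c :=
    fun w => s4p312_forall_mem_support (P := fun z => z ≠ t ∧ z ≠ m ∧ z ≠ tb ∧ z ≠ c) hG₀ w ha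
  have hPc : ∀ {u : V} (w : G₀.Walk pc u) (z : V), z ∈ w.support → z ≠ t ∧ z ≠ m ∧ z ≠ tb ∧ z ≠ c :=
    fun w => s4p312_forall_mem_support (P := fun z => z ≠ t ∧ z ≠ m ∧ z ≠ tb ∧ z ≠ c) hG₀ w hpc
  have hP1 : ∀ {u : V} (w : G₀.Walk p1 u) (z : V), z ∈ w.support → z ≠ t ∧ z ≠ m ∧ z ≠ tb ∧ z ≠ c :=
    fun w => s4p312_forall_mem_support (P := fun z => z ≠ t ∧ z ≠ m ∧ z ≠ tb ∧ z ≠ c) hG₀ w hp1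
  -- the glued walks are self-avoiding
  have hL : ∀ γ₀ : G₀.Path a ps,
      ((γ₀.1.transfer G (s4p312_edges_mem_of_le hle γ₀.1)).concat hpt).IsPath := fun γ₀ =>
    (γ₀.2.transfer _).concat (by rw [support_transfer]; exact fun h => (hPa γ₀.1 t h).1 rfl) hpt
  have hE : (cons hmtb (nil : G.Walk tb tb)).IsPath := by
    rw [cons_isPath_iff, support_nil, List.mem_singleton]
    exact ⟨IsPath.nil, hmtb'⟩
  have hD : ∀ {u : V} (δ : G₀.Walk u psb), δ.IsPath →
      (∀ z ∈ δ.support, z ≠ t ∧ z ≠ m ∧ z ≠ tb ∧ z ≠ c) →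
      ((δ.transfer G (s4p312_edges_mem_of_le hle δ)).concat hptb).IsPath ∧
        m ∉ ((δ.transfer G (s4p312_edges_mem_of_le hle δ)).concat hptb).support ∧
        c ∉ ((δ.transfer G (s4p312_edges_mem_of_le hle δ)).concat hptb).support := by
    intro u δ hδ hP
    rw [support_concat, support_transfer, List.mem_append, List.mem_singleton, not_or,
      List.mem_append, List.mem_singleton, not_or]
    exact ⟨(hδ.transfer _).concat (by rw [support_transfer]; exact fun h => (hP tb h).2.2.1 rfl) hptb,
      ⟨fun h => (hP m h).2.1 rfl, hmtb'⟩, fun h => (hP c h).2.2.2 rfl, fun h => htbc h.symm⟩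
  have hRc : ∀ δ : G₀.Path pc psb, (cons hmc (cons hcpc
      ((δ.1.transfer G (s4p312_edges_mem_of_le hle δ.1)).concat hptb))).IsPath := by
    intro δ
    obtain ⟨h1, h2, h3⟩ := hD δ.1 δ.2 (hPc δ.1)
    rw [cons_isPath_iff, cons_isPath_iff, support_cons, List.mem_cons, not_or]
    exact ⟨⟨h1, h3⟩, hmc', h2⟩
  have hR1 : ∀ δ : G₀.Path p1 psb,
      (cons hmp1 ((δ.1.transfer G (s4p312_edges_mem_of_le hle δ.1)).concat hptb)).IsPath := by
    intro δ
    obtain ⟨h1, h2, -⟩ := hD δ.1 δ.2 (hP1 δ.1)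
    rw [cons_isPath_iff]
    exact ⟨h1, h2⟩
  refine ⟨Sum.elim (fun γ₀ => (⟨_, hL γ₀⟩, ⟨_, hE⟩)) (Sum.elim (fun q => (⟨_, hL q.1⟩, ⟨_, hRc q.2⟩))
    (fun q => (⟨_, hL q.1⟩, ⟨_, hR1 q.2⟩))), ?_, ?_, ?_, ?_, ?_⟩
  · -- injectivity: inside each class by the edge lists, across classes by the second component
    refine (Function.Injective.sumElim (fun γ₀ γ₀' h => ?_) (Function.Injective.sumElim
      (fun q q' h => ?_) (fun q q' h => ?_) (fun q q' h => ?_))) (fun γ₀ q h => ?_)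
    · exact Subtype.ext (s4p312_glue_inj hle hpt (congrArg (fun q => q.1.1) h))
    · refine Prod.ext (Subtype.ext (s4p312_glue_inj hle hpt (congrArg (fun q => q.1.1) h)))
        (Subtype.ext (s4p312_glue_inj hle hptb ?_))
      have h2 := congrArg (fun q => q.2.1) h
      simp only [cons.injEq, heq_eq_eq, true_and] at h2
      exact h2
    · refine Prod.ext (Subtype.ext (s4p312_glue_inj hle hpt (congrArg (fun q => q.1.1) h)))
        (Subtype.ext (s4p312_glue_inj hle hptb ?_))
      have h2 := congrArg (fun q => q.2.1) h
      simp only [cons.injEq, heq_eq_eq, true_and] at h2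
      exact h2
    · have h2 := congrArg (fun q => q.2.1.snd) h
      simp only [snd_cons] at h2
      exact hp1.2.2.2 h2.symm
    · have h2 := congrArg (fun q => q.2.1.length) h
      rcases q with q | q
      all_goals
        simp only [Sum.elim_inl, Sum.elim_inr, length_cons, length_nil, length_concat] at h2
        omega
  · -- the range contains the disjoint pairs
    rintro ⟨γ, γ'⟩ hd
    have htγ' : t ∉ γ'.1.support := fun h => hd γ.1.end_mem_support h
    have hmγ : m ∉ γ.1.support := fun h => hd h γ'.1.start_mem_support
    have htbγ : tb ∉ γ.1.support := fun h => hd h γ'.1.end_mem_support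
    have hcγ : c ∉ γ.1.support := s4p312_deadEnd γ.1 γ.2 ha.2.2.2 htc
      (fun z hz hzγ => (hNc z hz).resolve_right fun hzm => hmγ (hzm ▸ hzγ))
    -- `γ` enters `t` from `ps` after a path of `G₀`
    obtain ⟨γ₀, hpt', hγ₀, hγ⟩ := s4p312_peel (P := fun z => z ≠ t ∧ z ≠ m ∧ z ≠ tb ∧ z ≠ c) hle
      hold γ.1 γ.2 ha.1 (fun v hv hvγ => (hNt v hv).resolve_right fun hvtb => htbγ (hvtb ▸ hvγ))
      (fun z hz hzt => ⟨hzt, fun hzm => hmγ (hzm ▸ hz), fun hztb => htbγ (hztb ▸ hz),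
        fun hzc => hcγ (hzc ▸ hz)⟩)
    -- the first step of `γ'`: to `p1` (a dip through `G₀`), to the corner `c` (then on to `pc` and a
    -- dip through `G₀`) or to `tb` (the rung)
    obtain ⟨v, hmv, q, hq⟩ := exists_eq_cons_of_ne hmtb' γ'.1
    have hq' := γ'.2
    rw [hq, cons_isPath_iff] at hq'
    have hqsub : ∀ z ∈ q.support, z ∈ γ'.1.support := fun z hz => by
      rw [hq, support_cons]
      exact List.mem_cons_of_mem _ hz
    rcases hNm v hmv with hv | hv | hv <;> subst v
    · have hcq : c ∉ q.support := s4p312_deadEnd q hq'.1 hp1.2.2.2 htbc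
        (fun z hz hzq => (hNc z hz).resolve_right fun hzm => hq'.2 (hzm ▸ hzq))
      obtain ⟨δ, hptb', hδ, hqδ⟩ := s4p312_peel (P := fun z => z ≠ t ∧ z ≠ m ∧ z ≠ tb ∧ z ≠ c)
        hle hold q hq'.1 hp1.2.2.1
        (fun u hu huq => (hNtb u hu).resolve_right fun h' => h'.elim
          (fun hum => hq'.2 (hum ▸ huq)) (fun hut => htγ' (hut ▸ hqsub u huq)))
        (fun z hz hztb => ⟨fun hzt => htγ' (hzt ▸ hqsub z hz), fun hzm => hq'.2 (hzm ▸ hz), hztb,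
          fun hzc => hcq (hzc ▸ hz)⟩)
      refine Set.mem_range.2 ⟨Sum.inr (Sum.inr (⟨γ₀, hγ₀⟩, ⟨δ, hδ⟩)), ?_⟩
      simp only [Sum.elim_inr]
      refine Prod.ext (Subtype.ext hγ.symm) (Subtype.ext ?_)
      change _ = γ'.1
      rw [hq, hqδ]
    · obtain ⟨w, hcw, q', hqq'⟩ := exists_eq_cons_of_ne htbc.symm q
      rw [hqq', cons_isPath_iff, support_cons, List.mem_cons, not_or] at hq'
      obtain ⟨⟨hq'p, hcq'⟩, -, hmq'⟩ := hq'
      have hq'sub : ∀ z ∈ q'.support, z ∈ γ'.1.support := fun z hz =>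
        hqsub z (by rw [hqq', support_cons]; exact List.mem_cons_of_mem _ hz)
      obtain rfl : pc = w :=
        ((hNc w hcw).resolve_right fun hwm => hmq' (hwm ▸ q'.start_mem_support)).symm
      obtain ⟨δ, hptb', hδ, hqδ⟩ := s4p312_peel (P := fun z => z ≠ t ∧ z ≠ m ∧ z ≠ tb ∧ z ≠ c)
        hle hold q' hq'p hpc.2.2.1
        (fun u hu huq => (hNtb u hu).resolve_right fun h' => h'.elim
          (fun hum => hmq' (hum ▸ huq)) (fun hut => htγ' (hut ▸ hq'sub u huq)))
        (fun z hz hztb => ⟨fun hzt => htγ' (hzt ▸ hq'sub z hz), fun hzm => hmq' (hzm ▸ hz), hztb,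
          fun hzc => hcq' (hzc ▸ hz)⟩)
      refine Set.mem_range.2 ⟨Sum.inr (Sum.inl (⟨γ₀, hγ₀⟩, ⟨δ, hδ⟩)), ?_⟩
      simp only [Sum.elim_inr, Sum.elim_inl]
      refine Prod.ext (Subtype.ext hγ.symm) (Subtype.ext ?_)
      change _ = γ'.1
      rw [hq, hqq', hqδ]
    · have hqnil : q = nil := eq_nil_iff_nil.2 (isPath_iff_nil.1 hq'.1)
      refine Set.mem_range.2 ⟨Sum.inl ⟨γ₀, hγ₀⟩, ?_⟩
      simp only [Sum.elim_inl]
      refine Prod.ext (Subtype.ext hγ.symm) (Subtype.ext ?_)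
      change _ = γ'.1
      rw [hq, hqnil]
  · -- the rung class: always disjoint; lengths
    intro γ₀
    simp only [Sum.elim_inl, support_concat, support_transfer, support_cons, support_nil,
      length_concat, length_transfer, length_cons, length_nil]
    refine ⟨fun z hz hz' => ?_, trivial, trivial⟩
    rw [List.mem_append, List.mem_singleton] at hz
    rw [List.mem_cons, List.mem_singleton] at hz'
    rcases hz with hz | rfl
    · exact hz'.elim (hPa γ₀.1 z hz).2.1 (hPa γ₀.1 z hz).2.2.1
    · exact hz'.elim htm httb
  · -- the corner class: disjoint iff the pieces are; lengths
    rintro ⟨γ₀, δ⟩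
    simp only [Sum.elim_inr, Sum.elim_inl, support_concat, support_transfer, support_cons,
      length_concat, length_transfer, length_cons]
    refine ⟨⟨fun h z hz hz' => h (List.mem_append_left _ hz)
      (List.mem_cons_of_mem _ (List.mem_cons_of_mem _ (List.mem_append_left _ hz'))),
      fun h z hz hz' => ?_⟩, trivial, trivial⟩
    rw [List.mem_append, List.mem_singleton] at hz
    rw [List.mem_cons, List.mem_cons, List.mem_append, List.mem_singleton] at hz'
    rcases hz with hz | rfl
    · rcases hz' with rfl | rfl | hz' | rfl
      exacts [(hPa γ₀.1 _ hz).2.1 rfl, (hPa γ₀.1 _ hz).2.2.2 rfl, h hz hz',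
        (hPa γ₀.1 _ hz).2.2.1 rfl]
    · rcases hz' with h' | h' | hz' | h'
      exacts [htm h', htc h', (hPc δ.1 _ hz').1 rfl, httb h']
  · -- the dipping class: disjoint iff the pieces are; lengths
    rintro ⟨γ₀, δ⟩
    simp only [Sum.elim_inr, support_concat, support_transfer, support_cons, length_concat,
      length_transfer, length_cons]
    refine ⟨⟨fun h z hz hz' => h (List.mem_append_left _ hz)
      (List.mem_cons_of_mem _ (List.mem_append_left _ hz')), fun h z hz hz' => ?_⟩, trivial, trivial⟩
    rw [List.mem_append, List.mem_singleton] at hz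
    rw [List.mem_cons, List.mem_append, List.mem_singleton] at hz'
    rcases hz with hz | rfl
    · rcases hz' with rfl | hz' | rfl
      exacts [(hPa γ₀.1 _ hz).2.1 rfl, h hz hz', (hPa γ₀.1 _ hz).2.2.1 rfl]
    · rcases hz' with h' | hz' | h'
      exacts [htm h', (hP1 δ.1 _ hz').1 rfl, httb h']

end Summit.CriticalPhenomena.SAWScalingLimit.Theorems.BoundaryTP2
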